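import Mathlib
import Summits.ValiantsHypothesis.ValiantsHypothesis.Theorems.GrenetZeonTwoDimCoefficientsScalingRayGeneral
import Summits.ValiantsHypothesis.ValiantsHypothesis.Theorems.GrenetZeonTwoDimCoefficientsScalingIndexHessianRate
import Summits.ValiantsHypothesis.ValiantsHypothesis.Theorems.GrenetZeonTwoDimCoefficientsDualUnipotentCalibration
import Summits.ValiantsHypothesis.ValiantsHypothesis.Theorems.GrenetZeonTwoDimCoefficientsDualUnipotentConstrainedPencil
import Summits.ValiantsHypothesis.ValiantsHypothesis.Theorems.GrenetZeonTwoDimCoefficientsScalingBlockTriangularCoupling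

/-!
# Crux `GrenetZeon.TwoDimCoefficients` (stmt-ValiantsHypothesis-8062) / rung `DualUnipotentThreeHalves` (stmt-24318):
# scaling-closure — RANK-ONE NUMERATORS ARE CHEAP FOR PENCILS OF ANY INDEX (the first priced coupling)

The per-free Hessian-rate law (✓ `rank_hess0_top_mul_le_of_index`, rate `2m²/n`) needs the pencil to have nil-index `n`;
the ledger inequality (✓ `sq_sub_rank_mul_le_of_levelCut`, p838815) prices every other constituent by its Hessian rank.  This
file prices the first constituent of ARBITRARY nil-index: a trace `X = tr(N^{n−1}·u vᵀ)` of a nilpotent linear pencil `N`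
(any index) against a RANK-ONE numerator `u vᵀ` (`u` a constant column, `v` a row of linear forms) that satisfies the HIGH
CONSTRAINTS `tr(N^k·u vᵀ) = 0` for `k ≥ n` — exactly what the representation constraints hand to a cut term
(✓ `trace_pow_mul_cut_eq_zero_of_classIndex`).  Bordering (as in ✓ `det_border_rankOne`): the affine pair
`A♯ = [[1, 0], [u, 1 − N]]`, `B♯ = [[0, −vᵀ], [0, 0]]` of size `m + 1` has `det(A♯ + X·B♯) = c·(1 + X·Σ_k tr(N^k·u vᵀ))`
(`c = det(1 − N)`), so its companions are `D_0 = c`, `D_1 = c·Σ_k tr(N^k·u vᵀ)` (degree `≤ n` by the high constraints, top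
piece `c·X`) and `D_k = 0` for `k ≥ 2`; the per-free engine ✓ `rank_hess0_top_le_of_simpleRayRoots` with ONE graded piece
gives

* ★★ `rank_hess0_trace_pow_vecMulVec_le` — `rank Hess X (z) ≤ 2(m + 1)` at EVERY point `z`, whatever the nil-index of `N`.

So in the ledger a rank-one back-coupling (or any rank-one-numerator class, wild or not) costs `O(m)`, not `O(m²/n)`:
★ `sq_sub_mul_le_of_levelCut_rankOneCut` — level-cut `N` with index-`n` classes whose cut term is such a rank-one trace obeys
`(n² − 2(m+1))·n ≤ 2·Σ_p s_p²`.  (Calibration, memo TWENTIETH-HAND.md §2: WITHOUT the high constraints a full-rank coupling of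
two index-`n` paths already has Hessian rank `≍ m²/8`; the located residual (P3′) is the full-rank constrained cut term.)

HONEST FRAMING: a thin new unconditional class; no stub is closed: `DualUnipotentBound`, crux 8062, the 24318 decl and
`VP ≠ VNP` remain open.

References: T. Mignon, N. Ressayre, Int. Math. Res. Not. 2004:79, Thm. 1.1 (via the tree); L. G. Valiant, Completeness
classes in algebra, STOC 1979, §2 (single-source programs are determinants — the bordering); folklore.
-/

-- single-conjunct layout `Summits/ValiantsHypothesis/ValiantsHypothesis`: the duplicated namespace
-- component is mandated by the tree.
set_option linter.dupNamespace false
set_option autoImplicit false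

noncomputable section

namespace Summit.ValiantsHypothesis.ValiantsHypothesis.Theorems.GrenetZeonTwoDimCoefficients.ScalingClosure

open MvPolynomial Matrix
open Literature.Computability.AlgebraicComplexity
open Summit.ValiantsHypothesis.ValiantsHypothesis.Cruxes.TwoDimCoefficients.DimTwoCases
open Summit.ValiantsHypothesis.ValiantsHypothesis.Theorems.GrenetZeon.SlowCore

section RankOneCoupling

variable {n m : ℕ}

/-- The bordered pencil-side matrix `A♯ = [[1, 0], [u, 1 − N]]` of size `m + 1` is affine. [folklore] -/
theorem isAffine_border_one_sub (N : AffMat n m) (hN : ∀ i j, (N i j).IsHomogeneous 1) (u : Fin m → ℂ) :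
    IsAffine (n := n) (m := m + 1) (border 1 0 (fun i => MvPolynomial.C (u i)) (1 - N)) := by
  intro i j
  refine Fin.cases ?_ (fun i' => ?_) i <;> refine Fin.cases ?_ (fun j' => ?_) j
  · rw [border_zero_zero, totalDegree_one]; exact Nat.zero_le _
  · rw [border_zero_succ, Pi.zero_apply, totalDegree_zero]; exact Nat.zero_le _
  · rw [border_succ_zero, totalDegree_C]; exact Nat.zero_le _
  · rw [border_succ_succ, Matrix.sub_apply]
    refine (totalDegree_sub _ _).trans (max_le ?_ (hN i' j').totalDegree_le)
    rw [Matrix.one_apply]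
    split_ifs
    · rw [totalDegree_one]; exact Nat.zero_le _
    · rw [totalDegree_zero]; exact Nat.zero_le _

/-- The bordered numerator-side matrix `B♯ = [[0, −vᵀ], [0, 0]]` is affine when `v` is linear. [folklore] -/
theorem isAffine_border_neg_row (v : Fin m → MvPolynomial (Fin n × Fin n) ℂ) (hv : ∀ j, (v j).IsHomogeneous 1) :
    IsAffine (n := n) (m := m + 1) (border 0 (fun j => -v j) 0 0) := by
  intro i j
  refine Fin.cases ?_ (fun i' => ?_) i <;> refine Fin.cases ?_ (fun j' => ?_) j
  · rw [border_zero_zero, totalDegree_zero]; exact Nat.zero_le _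
  · rw [border_zero_succ, totalDegree_neg]; exact (hv j').totalDegree_le
  · rw [border_succ_zero, Pi.zero_apply, totalDegree_zero]; exact Nat.zero_le _
  · rw [border_succ_succ, Matrix.zero_apply, totalDegree_zero]; exact Nat.zero_le _

/-- **The bordered determinant.**  `det(X·B♯ + A♯) = C(det(1 − N)) + X·C(tr(adj(1 − N)·u vᵀ))` in `S[X]`. [folklore] -/
theorem det_X_smul_border_add_border (N : AffMat n m) (u : Fin m → ℂ) (v : Fin m → MvPolynomial (Fin n × Fin n) ℂ) :
    det ((Polynomial.X : Polynomial (MvPolynomial (Fin n × Fin n) ℂ)) •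
        (border (0 : MvPolynomial (Fin n × Fin n) ℂ) (fun j => -v j) 0 0).map Polynomial.C +
      (border (1 : MvPolynomial (Fin n × Fin n) ℂ) 0 (fun i => MvPolynomial.C (u i)) (1 - N)).map Polynomial.C) =
    Polynomial.C (1 - N).det +
      Polynomial.X * Polynomial.C (((1 - N).adjugate * vecMulVec (fun i => MvPolynomial.C (u i)) v).trace) := by
  -- the matrix is itself a bordered matrix over `S[X]`
  have hmat : (Polynomial.X : Polynomial (MvPolynomial (Fin n × Fin n) ℂ)) •
        (border (0 : MvPolynomial (Fin n × Fin n) ℂ) (fun j => -v j) 0 0).map Polynomial.C +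
      (border (1 : MvPolynomial (Fin n × Fin n) ℂ) 0 (fun i => MvPolynomial.C (u i)) (1 - N)).map Polynomial.C =
      border 1 (fun j => -(Polynomial.X * Polynomial.C (v j))) (fun i => Polynomial.C (MvPolynomial.C (u i)))
        ((1 - N).map Polynomial.C) := by
    refine Matrix.ext fun i j => ?_
    refine Fin.cases ?_ (fun i' => ?_) i <;> refine Fin.cases ?_ (fun j' => ?_) j
    · rw [Matrix.add_apply, Matrix.smul_apply, Matrix.map_apply, Matrix.map_apply, border_zero_zero,
        border_zero_zero, border_zero_zero, Polynomial.C_0, smul_zero, zero_add, Polynomial.C_1]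
    · rw [Matrix.add_apply, Matrix.smul_apply, Matrix.map_apply, Matrix.map_apply, border_zero_succ,
        border_zero_succ, border_zero_succ, Pi.zero_apply, Polynomial.C_0, add_zero, Polynomial.C_neg, smul_neg,
        smul_eq_mul]
    · rw [Matrix.add_apply, Matrix.smul_apply, Matrix.map_apply, Matrix.map_apply, border_succ_zero,
        border_succ_zero, border_succ_zero, Pi.zero_apply, Polynomial.C_0, smul_zero, zero_add]
    · rw [Matrix.add_apply, Matrix.smul_apply, Matrix.map_apply, Matrix.map_apply, border_succ_succ,
        border_succ_succ, border_succ_succ, Matrix.zero_apply, Polynomial.C_0, smul_zero, zero_add, Matrix.map_apply]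
  have h2 : (border (1 : Polynomial (MvPolynomial (Fin n × Fin n) ℂ)) (fun j => -(Polynomial.X * Polynomial.C (v j)))
      (fun i => Polynomial.C (MvPolynomial.C (u i))) ((1 - N).map Polynomial.C)).det =
      ((1 - N).map Polynomial.C).det + Polynomial.X * (((1 - N).map Polynomial.C).adjugate *
        vecMulVec (fun i => Polynomial.C (MvPolynomial.C (u i))) (fun j => Polynomial.C (v j))).trace := by
    simpa only [one_mul] using det_border_rankOne (1 : Polynomial (MvPolynomial (Fin n × Fin n) ℂ)) Polynomial.X
      ((1 - N).map Polynomial.C) (fun i => Polynomial.C (MvPolynomial.C (u i))) (fun j => Polynomial.C (v j))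
  have hdet' : ((1 - N).map (Polynomial.C : MvPolynomial (Fin n × Fin n) ℂ → _)).det = Polynomial.C (1 - N).det := by
    rw [RingHom.map_det, RingHom.mapMatrix_apply]
  have hadj : ((1 - N).map (Polynomial.C : MvPolynomial (Fin n × Fin n) ℂ → _)).adjugate =
      (1 - N).adjugate.map Polynomial.C := by
    have h := RingHom.map_adjugate (Polynomial.C : MvPolynomial (Fin n × Fin n) ℂ →+* _) (1 - N)
    rw [RingHom.mapMatrix_apply, RingHom.mapMatrix_apply] at h
    exact h.symm
  have hvec : vecMulVec (fun i => Polynomial.C (MvPolynomial.C (u i))) (fun j => Polynomial.C (v j)) =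
      (vecMulVec (fun i => MvPolynomial.C (u i)) v).map (Polynomial.C : MvPolynomial (Fin n × Fin n) ℂ → _) := by
    refine Matrix.ext fun i j => ?_
    rw [vecMulVec_apply, Matrix.map_apply, vecMulVec_apply, Polynomial.C_mul]
  have htr' : (((1 - N).map (Polynomial.C : MvPolynomial (Fin n × Fin n) ℂ → _)).adjugate *
      vecMulVec (fun i => Polynomial.C (MvPolynomial.C (u i))) (fun j => Polynomial.C (v j))).trace =
      Polynomial.C (((1 - N).adjugate * vecMulVec (fun i => MvPolynomial.C (u i)) v).trace) := by
    rw [hadj, hvec, ← Matrix.map_mul, Matrix.trace, Matrix.trace, map_sum]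
    rfl
  rw [hmat, h2, hdet', htr']

/-- The companions of the bordered pair: `D_0 = c`, `D_1 = tr(adj(1 − N)·u vᵀ)`, `D_k = 0` for `k ≥ 2`. [folklore] -/
theorem coeff_det_X_smul_border_add_border (N : AffMat n m) (u : Fin m → ℂ)
    (v : Fin m → MvPolynomial (Fin n × Fin n) ℂ) (k : ℕ) :
    (det ((Polynomial.X : Polynomial (MvPolynomial (Fin n × Fin n) ℂ)) •
        (border (0 : MvPolynomial (Fin n × Fin n) ℂ) (fun j => -v j) 0 0).map Polynomial.C +
      (border (1 : MvPolynomial (Fin n × Fin n) ℂ) 0 (fun i => MvPolynomial.C (u i)) (1 - N)).map Polynomial.C)).coeff k =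
    if k = 0 then (1 - N).det
    else if k = 1 then ((1 - N).adjugate * vecMulVec (fun i => MvPolynomial.C (u i)) v).trace else 0 := by
  rw [det_X_smul_border_add_border, Polynomial.coeff_add, Polynomial.coeff_C]
  rcases k with _ | k
  · rw [if_pos rfl, Polynomial.coeff_X_mul_zero, add_zero, if_pos rfl]
  · rw [if_neg (Nat.succ_ne_zero k), zero_add, Polynomial.coeff_X_mul, Polynomial.coeff_C, if_neg (Nat.succ_ne_zero k)]
    rcases k with _ | k
    · rw [if_pos rfl, if_pos rfl]
    · rw [if_neg (Nat.succ_ne_zero k), if_neg (by omega)]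

/-- ★★ **Rank-one numerators are cheap, whatever the nil-index.**  Let `N` be a nilpotent `m × m` matrix of linear forms
(`N^m = 0`, ANY nil-index), `u` a constant vector, `v` a vector of linear forms, and suppose the HIGH CONSTRAINTS
`tr(N^k·u vᵀ) = 0` hold for all `k ≥ n` (`n ≥ 2`).  Then `X = tr(N^{n−1}·u vᵀ) = vᵀ(x)·N(x)^{n−1}·u` satisfies
`rank Hess X (z) ≤ 2(m + 1)` at EVERY point `z`.  (Bordering to the affine pair `[[1,0],[u,1−N]]`, `[[0,−vᵀ],[0,0]]` of size
`m + 1`, whose companions are `c`, `c·Σ_k tr(N^k·u vᵀ)`, `0, 0, …`; per-free engine ✓ `rank_hess0_top_le_of_simpleRayRoots`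
with one graded piece; density in `z`.) [cite: MignonRessayre2004, Thm. 1.1 — via the tree; folklore] -/
theorem rank_hess0_trace_pow_vecMulVec_le (hn : 2 ≤ n) (N : AffMat n m) (hN : ∀ i j, (N i j).IsHomogeneous 1)
    (hNm : N ^ m = 0) (u : Fin m → ℂ) (v : Fin m → MvPolynomial (Fin n × Fin n) ℂ) (hv : ∀ j, (v j).IsHomogeneous 1)
    (hhigh : ∀ k, n ≤ k → (N ^ k * vecMulVec (fun i => MvPolynomial.C (u i)) v).trace = 0)
    (z : Fin n × Fin n → ℂ) :
    (hess0 (transl z ((N ^ (n - 1) * vecMulVec (fun i => MvPolynomial.C (u i)) v).trace))).rank ≤ 2 * (m + 1) := by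
  classical
  -- trivial case `m < n`: then `N^{n-1} = 0`
  by_cases hmn : m ≤ n - 1
  · obtain ⟨d, hd⟩ : ∃ d, n - 1 = m + d := ⟨n - 1 - m, by omega⟩
    rw [hd, pow_add, hNm, zero_mul, Matrix.zero_mul, Matrix.trace_zero, map_zero, map_zero, Matrix.rank_zero]
    exact Nat.zero_le _
  have hnm : n - 1 < m := by omega
  -- homogeneity of the traces `W_k = tr(N^k·u vᵀ)` (degree `k + 1`)
  have hQh : ∀ i j, (vecMulVec (fun i => MvPolynomial.C (u i)) v i j).IsHomogeneous 1 := by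
    intro i j
    rw [vecMulVec_apply]
    simpa using (isHomogeneous_C (Fin n × Fin n) (u i)).mul (hv j)
  have hW : ∀ k, ((N ^ k * vecMulVec (fun i => MvPolynomial.C (u i)) v).trace).IsHomogeneous (k + 1) := fun k =>
    isHomogeneous_trace (isHomogeneous_mul_apply (isHomogeneous_pow_apply hN k) hQh)
  -- the constant `c = det(1 − N)` and the resolvent trace
  obtain ⟨c, hc, hcdet⟩ := exists_det_one_sub_eq_C N hNm
  have hT : ((1 - N).adjugate * vecMulVec (fun i => MvPolynomial.C (u i)) v).trace =
      MvPolynomial.C c * ∑ k ∈ Finset.range m, (N ^ k * vecMulVec (fun i => MvPolynomial.C (u i)) v).trace := by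
    rw [trace_adjugate_one_sub_mul N _ hNm, hcdet]
  have hTcomp : ∀ d, homogeneousComponent d (((1 - N).adjugate * vecMulVec (fun i => MvPolynomial.C (u i)) v).trace) =
      MvPolynomial.C c * ∑ k ∈ Finset.range m,
        (if d = k + 1 then (N ^ k * vecMulVec (fun i => MvPolynomial.C (u i)) v).trace else 0) := by
    intro d
    rw [hT, homogeneousComponent_C_mul, map_sum]
    congr 1
    exact Finset.sum_congr rfl fun k _ => homogeneousComponent_of_isHomogeneous (hW k) d
  -- the top piece is `c·X`, the higher pieces vanish by the high constraints
  have hTtop : homogeneousComponent n (((1 - N).adjugate * vecMulVec (fun i => MvPolynomial.C (u i)) v).trace) =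
      MvPolynomial.C c * (N ^ (n - 1) * vecMulVec (fun i => MvPolynomial.C (u i)) v).trace := by
    rw [hTcomp, Finset.sum_eq_single_of_mem (n - 1) (Finset.mem_range.mpr hnm) (fun k _ hk => if_neg (by omega)),
      if_pos (by omega)]
  have hThigh : ∀ d, n < d →
      homogeneousComponent d (((1 - N).adjugate * vecMulVec (fun i => MvPolynomial.C (u i)) v).trace) = 0 := by
    intro d hd
    rw [hTcomp]
    have hzero : ∑ k ∈ Finset.range m,
        (if d = k + 1 then (N ^ k * vecMulVec (fun i => MvPolynomial.C (u i)) v).trace else 0) = 0 := by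
      refine Finset.sum_eq_zero fun k _ => ?_
      split_ifs with hdk
      · exact hhigh k (by omega)
      · rfl
    rw [hzero, mul_zero]
  -- the bordered pair and its companions
  have hAs : IsAffine (n := n) (m := m + 1) (border 1 0 (fun i => MvPolynomial.C (u i)) (1 - N)) :=
    isAffine_border_one_sub N hN u
  have hBs : IsAffine (n := n) (m := m + 1) (border 0 (fun j => -v j) 0 0) := isAffine_border_neg_row v hv
  obtain ⟨D, hD⟩ : ∃ D : ℕ → MvPolynomial (Fin n × Fin n) ℂ, ∀ k, D k =
      (det ((Polynomial.X : Polynomial (MvPolynomial (Fin n × Fin n) ℂ)) •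
        (border (0 : MvPolynomial (Fin n × Fin n) ℂ) (fun j => -v j) 0 0).map Polynomial.C +
      (border (1 : MvPolynomial (Fin n × Fin n) ℂ) 0 (fun i => MvPolynomial.C (u i)) (1 - N)).map Polynomial.C)).coeff k :=
    ⟨_, fun _ => rfl⟩
  have hDval : ∀ k, D k = if k = 0 then (1 - N).det
      else if k = 1 then ((1 - N).adjugate * vecMulVec (fun i => MvPolynomial.C (u i)) v).trace else 0 := fun k => by
    rw [hD k, coeff_det_X_smul_border_add_border]
  have hD0 : D 0 = MvPolynomial.C c := by rw [hDval, if_pos rfl, hcdet]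
  have hD1 : D 1 = ((1 - N).adjugate * vecMulVec (fun i => MvPolynomial.C (u i)) v).trace := by
    rw [hDval, if_neg one_ne_zero, if_pos rfl]
  have hDk : ∀ k, 2 ≤ k → D k = 0 := fun k hk => by
    rw [hDval, if_neg (by omega), if_neg (by omega)]
  have hdeg : ∀ k, ∀ d, k * n < d → homogeneousComponent d (D k) = 0 := by
    intro k d hkd
    rcases Nat.lt_or_ge k 2 with hk | hk
    · interval_cases k
      · rw [hD0, homogeneousComponent_of_isHomogeneous (isHomogeneous_C _ c) d, if_neg (by omega)]
      · rw [hD1]; exact hThigh d (by omega)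
    · rw [hDk k hk, map_zero]
  have hJ : ∀ k, 1 < k → k ≤ m + 1 → homogeneousComponent (k * n) (D k) = 0 := fun k hk _ => by
    rw [hDk k (by omega), map_zero]
  have htop : homogeneousComponent n (D 1) =
      MvPolynomial.C c * (N ^ (n - 1) * vecMulVec (fun i => MvPolynomial.C (u i)) v).trace := by rw [hD1, hTtop]
  -- the engine at a point where `X ≠ 0`
  have hgood : ∀ z₀ : Fin n × Fin n → ℂ,
      eval z₀ ((N ^ (n - 1) * vecMulVec (fun i => MvPolynomial.C (u i)) v).trace) ≠ 0 →
      (hess0 (transl z₀ ((N ^ (n - 1) * vecMulVec (fun i => MvPolynomial.C (u i)) v).trace))).rank ≤ 2 * (m + 1) := by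
    intro z₀ hz₀
    set E : ℂ := eval z₀ (homogeneousComponent n (D 1)) with hE
    have hEval : E = c * eval z₀ ((N ^ (n - 1) * vecMulVec (fun i => MvPolynomial.C (u i)) v).trace) := by
      rw [hE, htop, map_mul, MvPolynomial.eval_C]
    have hE0 : E ≠ 0 := by rw [hEval]; exact mul_ne_zero hc hz₀
    set t : Fin 1 → ℂ := fun _ => -(c * E⁻¹) with ht
    have htinj : Function.Injective t := fun a b _ => Subsingleton.elim a b
    have htE : -(c * E⁻¹) * E = -c := by rw [neg_mul, mul_assoc, inv_mul_cancel₀ hE0, mul_one]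
    have hroot : ∀ i, c + ∑ e : Fin 1, t i ^ ((e : ℕ) + 1) *
        eval z₀ (homogeneousComponent (((e : ℕ) + 1) * n) (D (e + 1))) = 0 := by
      intro i
      rw [Fin.sum_univ_one]
      simp only [Fin.isValue, Fin.val_zero, zero_add, one_mul, pow_one, ht]
      rw [← hE, htE, add_neg_cancel]
    have hsimple : ∀ i, ∑ e : Fin 1, (((e : ℕ) + 1 : ℕ) : ℂ) * (t i ^ ((e : ℕ) + 1) *
        eval z₀ (homogeneousComponent (((e : ℕ) + 1) * n) (D (e + 1)))) ≠ 0 := by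
      intro i
      rw [Fin.sum_univ_one]
      simp only [Fin.isValue, Fin.val_zero, zero_add, Nat.cast_one, one_mul, pow_one, ht]
      rw [← hE, htE]
      exact neg_ne_zero.mpr hc
    have hbound := rank_hess0_top_le_of_simpleRayRoots _ _ hAs hBs c hn D hD hD0 hdeg (J := 1) le_rfl (by omega) hJ
      z₀ t htinj hroot hsimple
    rw [one_mul, htop, map_mul, MvPolynomial.algHom_C, MvPolynomial.algebraMap_eq, hess0_C_mul] at hbound
    have hsm : hess0 (transl z₀ ((N ^ (n - 1) * vecMulVec (fun i => MvPolynomial.C (u i)) v).trace)) =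
        c⁻¹ • (c • hess0 (transl z₀ ((N ^ (n - 1) * vecMulVec (fun i => MvPolynomial.C (u i)) v).trace))) := by
      rw [smul_smul, inv_mul_cancel₀ hc, one_smul]
    rw [hsm]
    exact (rank_smul_le _ _).trans hbound
  -- density: a non-zero `ρ`-minor of the polynomial Hessian and a non-root of `X`
  set X : MvPolynomial (Fin n × Fin n) ℂ := (N ^ (n - 1) * vecMulVec (fun i => MvPolynomial.C (u i)) v).trace with hXdef
  set ρ : ℕ := (hess0 (transl z X)).rank with hρdef
  rcases Nat.eq_zero_or_pos ρ with hρ0 | hρpos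
  · rw [hρ0]; exact Nat.zero_le _
  obtain ⟨ρ', hρ'⟩ : ∃ ρ', ρ = ρ' + 1 := ⟨ρ - 1, by omega⟩
  obtain ⟨τ₁, τ₂, hτ⟩ := (succ_le_rank_iff_exists_det_submatrix_ne_zero (hess0 (transl z X)) ρ').mp (by rw [← hρ'])
  set H : MvPolynomial (Fin n × Fin n) ℂ :=
    ((Matrix.of fun s t : Fin n × Fin n => pderiv s (pderiv t X)).submatrix τ₁ τ₂).det with hH
  have hHeval : ∀ w : Fin n × Fin n → ℂ, eval w H = ((hess0 (transl w X)).submatrix τ₁ τ₂).det := fun w =>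
    Summit.ValiantsHypothesis.ValiantsHypothesis.Theorems.GrenetZeon.HessianRankCodimTwo.eval_det_submatrix_hessMatrix
      X w τ₁ τ₂
  have hH0 : H ≠ 0 := fun h => hτ (by rw [← hHeval, h, map_zero])
  have hX0 : X ≠ 0 := by
    intro h0
    apply hH0
    rw [hH, h0]
    have hzero : (Matrix.of fun s t : Fin n × Fin n =>
        pderiv s (pderiv t (0 : MvPolynomial (Fin n × Fin n) ℂ))) = 0 := by
      apply Matrix.ext; intro s t; rw [Matrix.of_apply, map_zero, map_zero, Matrix.zero_apply]
    rw [hzero, Matrix.submatrix_zero, Pi.zero_apply, Pi.zero_apply, Matrix.det_zero]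
  obtain ⟨z₀, hz₀⟩ := exists_eval_ne_zero_of_ne_zero (H * X) (mul_ne_zero hH0 hX0)
  rw [map_mul] at hz₀
  have hHz : eval z₀ H ≠ 0 := fun h => hz₀ (by rw [h, zero_mul])
  have hXz : eval z₀ X ≠ 0 := fun h => hz₀ (by rw [h, mul_zero])
  have hρle : ρ ≤ (hess0 (transl z₀ X)).rank := by
    rw [hρ']
    exact (succ_le_rank_iff_exists_det_submatrix_ne_zero _ ρ').mpr ⟨τ₁, τ₂, by rw [← hHeval]; exact hHz⟩
  exact hρle.trans (hgood z₀ hXz)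

/-- ★ **Rank-one back-coupling is cheap (ledger form).**  Normal form `per_n = tr(N^{n−1}M)` with `N, M` linear,
`N^m = 0`, the representation constraints `tr(N^k·M) = 0` for `k ≥ n` (✓ `exists_constrained_pencil_of_dualUnipotentRepr`),
`N` level-cut for `lvl` with every class pencil of nil-index `≤ n`, and a RANK-ONE cut part `M^cut = u·vᵀ` (`u` constant,
`v` linear).  Then `(n² − 2(m+1))·n ≤ 2·Σ_p s_p²` (`≤ 2m²`): the 3/2 rung survives the coupling.
[cite: MignonRessayre2004, Thm. 1.1 — via the tree; folklore] -/
theorem sq_sub_mul_le_of_levelCut_rankOneCut (hn : 2 ≤ n) (N M : AffMat n m)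
    (hN : ∀ i j, (N i j).IsHomogeneous 1) (hM : ∀ i j, (M i j).IsHomogeneous 1) (hNm : N ^ m = 0)
    (hper : perPoly (Fin n) ℂ = (N ^ (n - 1) * M).trace)
    (hconstr : ∀ k, n ≤ k → (N ^ k * M).trace = 0)
    (lvl : Fin m → ℕ) (hcut : ∀ a b, lvl a < lvl b → N a b = 0)
    (s : ℕ → ℕ) (e : ∀ p : ℕ, {i : Fin m // lvl i = p} ≃ Fin (s p))
    (hindex : ∀ p ∈ Finset.univ.image lvl, (classPencil N (e p)) ^ n = 0)
    (u : Fin m → ℂ) (v : Fin m → MvPolynomial (Fin n × Fin n) ℂ) (hv : ∀ j, (v j).IsHomogeneous 1)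
    (hMcut : Matrix.of (fun i j : Fin m => if lvl i < lvl j then M i j else 0) = vecMulVec (fun i => MvPolynomial.C (u i)) v) :
    (n ^ 2 - 2 * (m + 1)) * n ≤ 2 * ∑ p ∈ Finset.univ.image lvl, s p ^ 2 := by
  classical
  have h := sq_sub_rank_mul_le_of_levelCut hn N M hN hM hper lvl hcut s e (Finset.univ.image lvl)
    (Finset.Subset.refl _) hindex
  have hempty : (Finset.univ.image lvl).filter (fun p => p ∉ Finset.univ.image lvl) = ∅ := by
    ext p
    simp only [Finset.mem_filter, Finset.notMem_empty, iff_false, not_and, not_not]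
    exact fun hp => hp
  rw [hempty, Finset.sum_empty, zero_add, hMcut] at h
  -- the high constraints descend to the rank-one cut term
  have hhigh : ∀ k, n ≤ k → (N ^ k * vecMulVec (fun i => MvPolynomial.C (u i)) v).trace = 0 := by
    intro k hk
    rw [← hMcut]
    exact trace_pow_mul_cut_eq_zero_of_classIndex lvl N M hcut s e hindex k hk (hconstr k hk)
  have hrank := rank_hess0_trace_pow_vecMulVec_le hn N hN hNm u v hv hhigh
    (fun w : Fin n × Fin n => if w.1 = (1 : Equiv.Perm (Fin n)) w.2 then (1 : ℂ) else 0)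
  exact (Nat.mul_le_mul_right _ (by omega)).trans h

/-- A trace against a rank-one matrix, transposed: `tr(P·u vᵀ) = tr(Pᵀ·v uᵀ)`. [folklore] -/
theorem trace_mul_vecMulVec_eq_transpose {R : Type*} [CommRing R] {k : ℕ} (P : Matrix (Fin k) (Fin k) R)
    (u v : Fin k → R) : (P * vecMulVec u v).trace = (Pᵀ * vecMulVec v u).trace := by
  rw [← Matrix.trace_transpose (P * vecMulVec u v), Matrix.transpose_mul, Matrix.transpose_vecMulVec,
    Matrix.trace_mul_comm]

/-- ★ **Rank-one numerators are cheap — transposed orientation** (`u` linear, `v` constant): under the high constraints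
`tr(N^k·u vᵀ) = 0` for `k ≥ n`, `rank Hess tr(N^{n−1}·u vᵀ)(z) ≤ 2(m + 1)` at every point, whatever the nil-index of `N`.
(A matrix of linear forms of rank one is `u vᵀ` with one factor constant, so together with
✓ `rank_hess0_trace_pow_vecMulVec_le` this prices EVERY rank-one cut part.) [cite: MignonRessayre2004, Thm. 1.1 — via the
tree; folklore] -/
theorem rank_hess0_trace_pow_vecMulVec_le' (hn : 2 ≤ n) (N : AffMat n m) (hN : ∀ i j, (N i j).IsHomogeneous 1)
    (hNm : N ^ m = 0) (u : Fin m → MvPolynomial (Fin n × Fin n) ℂ) (hu : ∀ i, (u i).IsHomogeneous 1) (v : Fin m → ℂ)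
    (hhigh : ∀ k, n ≤ k → (N ^ k * vecMulVec u (fun j => MvPolynomial.C (v j))).trace = 0)
    (z : Fin n × Fin n → ℂ) :
    (hess0 (transl z ((N ^ (n - 1) * vecMulVec u (fun j => MvPolynomial.C (v j))).trace))).rank ≤ 2 * (m + 1) := by
  have hNt : ∀ i j, (Nᵀ i j).IsHomogeneous 1 := fun i j => hN j i
  have hNtm : Nᵀ ^ m = 0 := by rw [← Matrix.transpose_pow, hNm, Matrix.transpose_zero]
  have hhigh' : ∀ k, n ≤ k → (Nᵀ ^ k * vecMulVec (fun j => MvPolynomial.C (v j)) u).trace = 0 := by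
    intro k hk
    rw [← Matrix.transpose_pow, ← trace_mul_vecMulVec_eq_transpose, hhigh k hk]
  rw [trace_mul_vecMulVec_eq_transpose, Matrix.transpose_pow]
  exact rank_hess0_trace_pow_vecMulVec_le hn Nᵀ hNt hNtm v u hu hhigh' z

end RankOneCoupling

end Summit.ValiantsHypothesis.ValiantsHypothesis.Theorems.GrenetZeonTwoDimCoefficients.ScalingClosure

end
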